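import Literature.NumberTheory.EllipticCurves.TwoDescentOneRootKummerBridge
import Literature.NumberTheory.EllipticCurves.TwoDescentOneRootH1Injective
import Literature.NumberTheory.EllipticCurves.TwoDescentKummerBridgeLocal
import HarnessLib

/-!
# The one-root descent–Kummer bridge at a completion: Selmer classes are locally Cassels classes

One-root twin of `TwoDescentKummerBridgeLocal.lean` (which assumes SPLIT `2`-torsion). For an elliptic
curve `E/K` (`char K = 0`), ONE rational root `θ ∈ K` of the `2`-division cubic (`IsTwoTorsionX`, the
`2`-torsion point `T_θ`) and a `K`-field `E` (a completion `K_v`), the tree's `2`-Selmer group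
`Sel⁽²⁾(E/K) ⊆ H¹(K, E[2])` is cut out by the local Kummer conditions
`𝓛_E = kummerLocalConditionAt W 2 E` (`KummerSelmerStructure.lean`), and `𝓛_E` is the image of the local
Kummer map of `W⁄E` (`LocalKummerMap.lean`: `range_localKummerMap`,
`localKummerMap_eq_cohomologyMap_kummerMapTorsion`). This file reads all of that through the character
`χ_θ` of `TwoDescentOneRootCharacter.lean` and Kummer theory, using the bridge
`kummerEquiv ∘ H¹(χ_θ) ∘ κ = oneRootComponent θ` of `TwoDescentOneRootKummerBridge.lean` for `W⁄E` and
the naturality of Kummer theory for restriction (`KummerRestriction.lean`):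

* `resOneRootChar W E h : E[2](K̄) →+ μ₂(Ē)` — `χ_θ` read in `Ē` (`Γ_E`-equivariant), and the induced
  `resOneRootCharH1 : H¹(Γ_E, E[2](K̄)|_{Γ_E}) →+ H¹(E, μ₂(Ē))`;
* `resOneRootCharH1_res`: **naturality** `H¹(χ_θ|_E)(res c) = resMu (H¹(χ_θ) c)`;
* `torsionTransferEquiv_geomOneRoot` (`T_θ ↦ T_θ` across `K̄ → Ē`), `resOneRootChar_torsionTransferEquiv_symm`
  and `resOneRootCharH1_cohomologyMap_torsionTransferInvHom`: **the restricted character of `W` is the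
  character of `W⁄E`** (at the root `θ ∈ E`) across the torsion transfer;
* `exists_kummerEquiv_resOneRootCharH1_eq_of_mem_kummerLocalConditionAt`: **the local Kummer image is
  the Cassels image** — every `c ∈ 𝓛_E` has `θ`-component in `Eˣ/Eˣ²` equal to
  `oneRootComponent θ P` for some `P ∈ (W⁄E)(E)`;
* `exists_kummerEquiv_resMu_oneRootCharH1_eq_of_res_mem`, `exists_oneRootComponent_eq_of_res_mem`,
  `exists_oneRootComponent_eq_of_mem_selmerGroup`: **the localised global component** — for
  `c ∈ Sel⁽²⁾(E/K)` with `kummerEquiv K 2 (H¹(χ_θ) c) = [a]`, `a ∈ Kˣ`, and a place `v`, the class of `a`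
  in `K_vˣ/K_vˣ²` is the Cassels value `x(P) − θ` of a point `P ∈ E(K_v)` (`c(θ)` at `T_θ`, `1` at `O`);
* `exists_oneRootComponent_eq_of_mem_selmerGroup_of_resTorsion` — the same for a curve over a SUBFIELD
  `k ⊂ K` (e.g. `k = ℚ`, `K = ℚ(θ)` the cubic `2`-division field): the cohomological one-root descent map
  `Φ = kummerEquiv ∘ oneRootDescentH1 : H¹(k, E[2]) → Kˣ/Kˣ²` of `TwoDescentOneRootH1Injective.lean`
  (injective for irreducible `E[2]`) sends `Sel⁽²⁾(E/k)` to classes that are, at EVERY place `v` of `K`,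
  Cassels values of `K_v`-points — the local half of "`Φ(Sel⁽²⁾(E/k)) ⊆` admissible classes".

Hence a `2`-Selmer class, written in `Kˣ/Kˣ²` through one root, lies at every completion in the image of
the classical one-root descent map of `E(K_v)`; the explicit local images (even valuation at good odd
places, the connected components at real places, the dyadic images) and the global assembly (`K(S, 2)`,
norm condition) are left to sequels. Definitions with bodies and theorems only; no named fact, no `sorry`.
Seat `bsd-line-spt-p1` (g29), milestone S4 of the `2`-Selmer upgrade of the kernel general `2`-descent.

## References

* [SilvermanAEC2009] J. H. Silverman, *The Arithmetic of Elliptic Curves*, 2nd ed., GTM 106,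
  Springer 2009, Thm. X.1.1, Prop. X.1.4, X.§4 (diagram (**) before Thm. X.4.2, Prop. X.4.9).
* [Cassels1991LecturesEllipticCurves] J. W. S. Cassels, *Lectures on Elliptic Curves*, LMSST 24, CUP 1991,
  §15 (μ on the Selmer group: "everywhere locally in the image").
* [SerreGaloisCohomology1997] J.-P. Serre, *Galois Cohomology*, Springer 1997, I §2.4, II §1.2.
-/

noncomputable section

open scoped Classical

open Field

universe u

namespace WeierstrassCurve

open Literature.NumberTheory.GaloisRepresentations Literature.NumberTheory.EllipticCurves Field
open WeierstrassCurve.Affine DiscreteGaloisModule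

variable {K : Type u} [Field K] [CharZero K] (W : WeierstrassCurve K) [W.IsElliptic] {θ : K}
variable (E : Type u) [Field E] [Algebra K E]

/-! ### The restricted character `E[2](K̄)|_{Γ_E} → μ₂(Ē)` -/

/-- The character `χ_θ` of `T_θ`, restricted to `Γ_E` and read in `μ₂(Ē)` along the chosen embedding
`K̄ → Ē`: `T ↦ ι(χ_θ T)`. [cite: SilvermanAEC2009, Thm. X.1.1] -/
def resOneRootChar (h : W.toAffine.IsTwoTorsionX θ) :
    geomTorsion W 2 →+ MuCarrier E 2 :=
  (muTransfer K E 2).comp (W.oneRootChar h)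

/-- Unfolding `resOneRootChar`. [cite: SilvermanAEC2009, Thm. X.1.1] -/
theorem resOneRootChar_apply (h : W.toAffine.IsTwoTorsionX θ) (T : geomTorsion W 2) :
    W.resOneRootChar E h T = muTransfer K E 2 (W.oneRootChar h T) :=
  rfl

/-- `resOneRootChar` is `Γ_E`-equivariant (`Γ_E` acting on `E[2](K̄)` through
`absGaloisRestrict K E`). [cite: SerreGaloisCohomology1997, I §2.4] -/
theorem resOneRootChar_smul (h : W.toAffine.IsTwoTorsionX θ) (σ : absoluteGaloisGroup E)
    (T : geomTorsion W 2) :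
    W.resOneRootChar E h (absGaloisRestrict K E σ • T) = mu E 2 σ (W.resOneRootChar E h T) := by
  rw [resOneRootChar_apply, resOneRootChar_apply, oneRootChar_smul, muTransfer_mu]

/-- The restricted character as a morphism of `Γ_E`-modules `E[2](K̄)|_{Γ_E} → μ₂(Ē)` in `TopRep ℤ Γ_E`.
[cite: SerreGaloisCohomology1997, I §2.4] -/
def resOneRootCharHom (h : W.toAffine.IsTwoTorsionX θ) :
    DiscreteGaloisModule.toTopRep (GaloisRep.restrictField E (W.torsionGaloisModule 2)) ⟶
      (mu E 2).toTopRep :=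
  TopRep.ofHom
    { toLinearMap := (W.resOneRootChar E h).toIntLinearMap
      cont := continuous_of_discreteTopology
      isIntertwining' := fun σ ↦ by
        ext T
        exact W.resOneRootChar_smul E h σ T }

/-- Values of `resOneRootCharHom`. [cite: SerreGaloisCohomology1997, I §2.4] -/
@[simp]
theorem resOneRootCharHom_hom_apply (h : W.toAffine.IsTwoTorsionX θ) (T : geomTorsion W 2) :
    (W.resOneRootCharHom E h).hom T = W.resOneRootChar E h T :=
  rfl

/-- **`H¹(Γ_E, E[2](K̄)|_{Γ_E}) →+ H¹(E, μ₂(Ē))`**, induced by the restricted character `χ_θ|_E`.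
[cite: SerreGaloisCohomology1997, I §2.4] -/
def resOneRootCharH1 (h : W.toAffine.IsTwoTorsionX θ) :
    galoisCohomology (GaloisRep.restrictField E (W.torsionGaloisModule 2)) 1 →+
      galoisCohomology (mu E 2) 1 :=
  (cohomologyMap (W.resOneRootCharHom E h) 1).hom.toLinearMap.toAddMonoidHom

/-- `resOneRootCharH1` on explicit cocycles. [cite: SerreGaloisCohomology1997, I §2.4] -/
theorem resOneRootCharH1_oneCocycleClass (h : W.toAffine.IsTwoTorsionX θ)
    (ψ : contOneCocycles (DiscreteGaloisModule.toTopRep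
      (GaloisRep.restrictField E (W.torsionGaloisModule 2)))) :
    W.resOneRootCharH1 E h (oneCocycleClass _ ψ) =
      oneCocycleClass _ (contOneCocycles.pullback (ContinuousMonoidHom.id (absoluteGaloisGroup E))
        (resIdHom (W.resOneRootCharHom E h)) ψ) :=
  cohomologyMap_oneCocycleClass _ ψ

/-! ### Naturality: restricting the global component -/

/-- **Naturality of the `θ`-component for restriction**:
`H¹(χ_θ|_E)(res c) = resMu (H¹(χ_θ) c)` for every `c ∈ H¹(K, E[2])` (both are the class of
`σ ↦ ι(χ_θ(φ(σ|_{K̄})))`). [cite: SerreGaloisCohomology1997, I §2.4] -/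
theorem resOneRootCharH1_res (h : W.toAffine.IsTwoTorsionX θ) (c : galH1Torsion W 2) :
    W.resOneRootCharH1 E h (galoisCohomology.res (W.torsionGaloisModule 2) E 1 c) =
      resMu K E 2 (W.oneRootCharH1 h c) := by
  obtain ⟨φ, rfl⟩ := oneCocycleClass_surjective _ c
  rw [res_torsionGaloisModule_oneCocycleClass, resOneRootCharH1_oneCocycleClass,
    oneRootCharH1_oneCocycleClass, resMu_oneCocycleClass]
  congr 1

/-! ### Transport along `E[2](K̄) ≃ (W⁄E)[2](Ē)`: the characters of `W` and of `W⁄E` agree -/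

variable [CharZero E]

/-- **`T_θ` transfers to `T_θ`**: under `torsionTransferEquiv : E[2](K̄) ≃ (W⁄E)[2](Ē)` (the identity on
coordinates across `K̄ → Ē`), the `2`-torsion point `T_θ = (θ, *)` of `W` goes to the point `T_θ` of `W⁄E`
at the root `θ ∈ E`. [cite: SilvermanAEC2009, Prop. X.1.4] -/
theorem torsionTransferEquiv_geomOneRoot (h : W.toAffine.IsTwoTorsionX θ) [(W.baseChange E).IsElliptic] :
    W.torsionTransferEquiv (E := E) (two_ne_zero : (2 : ℤ) ≠ 0) ⟨W.geomOneRoot h, W.geomOneRoot_mem h⟩ =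
      ⟨(W.baseChange E).geomOneRoot (W.isTwoTorsionX_baseChange h E),
        (W.baseChange E).geomOneRoot_mem (W.isTwoTorsionX_baseChange h E)⟩ := by
  apply Subtype.ext
  rw [coe_torsionTransferEquiv_apply, AddEquiv.symm_apply_eq]
  unfold geomOneRoot
  rw [baseChangeGeomPointsEquiv_some]
  show Affine.Point.map (W' := W) (closureEmb (K := K) E) (Affine.Point.some _ _ _) = _
  rw [Affine.Point.map_some]
  simp only [Affine.Point.some.injEq]
  constructor
  · rw [AlgHom.commutes, IsScalarTower.algebraMap_apply K E (AlgebraicClosure E)]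
  · simp only [twoTorsionY, baseChange, map_a₁, map_a₃, map_neg, map_div₀, map_add, map_mul,
      map_ofNat, AlgHom.commutes, ← IsScalarTower.algebraMap_apply K E (AlgebraicClosure E)]

/-- **The restricted character of `W` is the character of `W⁄E`** across the torsion transfer:
`ι(χ_θ(A⁻¹ S)) = χ_θ^{W⁄E}(S)` for `S ∈ (W⁄E)[2](Ē)` (both are `1` on `{O, T_θ}` and `-1` otherwise, and
`A = torsionTransferEquiv` preserves `O` and `T_θ`). [cite: SilvermanAEC2009, Thm. X.1.1] -/
theorem resOneRootChar_torsionTransferEquiv_symm (h : W.toAffine.IsTwoTorsionX θ)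
    [(W.baseChange E).IsElliptic] (S : geomTorsion (W.baseChange E) 2) :
    W.resOneRootChar E h ((W.torsionTransferEquiv (E := E) (two_ne_zero : (2 : ℤ) ≠ 0)).symm S) =
      (W.baseChange E).oneRootChar (W.isTwoTorsionX_baseChange h E) S := by
  set A := W.torsionTransferEquiv (E := E) (two_ne_zero : (2 : ℤ) ≠ 0)
  have hT := W.torsionTransferEquiv_geomOneRoot E h
  apply muVal_injective E 2
  rw [resOneRootChar_apply, muVal_muTransfer, oneRootChar_apply, oneRootChar_apply,
    muVal_oneRootCharFun, muVal_oneRootCharFun]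
  have h0 : ((A.symm S : geomTorsion W 2) : geomPoints W) = 0 ↔
      ((S : geomTorsion (W.baseChange E) 2) : geomPoints (W.baseChange E)) = 0 := by
    rw [← AddSubgroup.coe_zero, Subtype.coe_inj, ← AddSubgroup.coe_zero (H := geomTorsion (W.baseChange E) 2),
      Subtype.coe_inj, AddEquiv.map_eq_zero_iff]
  have h1 : ((A.symm S : geomTorsion W 2) : geomPoints W) = W.geomOneRoot h ↔
      ((S : geomTorsion (W.baseChange E) 2) : geomPoints (W.baseChange E)) =
        (W.baseChange E).geomOneRoot (W.isTwoTorsionX_baseChange h E) := by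
    constructor
    · intro hS
      have : A.symm S = ⟨W.geomOneRoot h, W.geomOneRoot_mem h⟩ := Subtype.ext hS
      rw [AddEquiv.symm_apply_eq, hT] at this
      rw [this]
    · intro hS
      have : S = ⟨(W.baseChange E).geomOneRoot (W.isTwoTorsionX_baseChange h E),
          (W.baseChange E).geomOneRoot_mem (W.isTwoTorsionX_baseChange h E)⟩ := Subtype.ext hS
      rw [this, ← hT, AddEquiv.symm_apply_apply]
  by_cases hc : ((S : geomTorsion (W.baseChange E) 2) : geomPoints (W.baseChange E)) = 0 ∨
      ((S : geomTorsion (W.baseChange E) 2) : geomPoints (W.baseChange E)) =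
        (W.baseChange E).geomOneRoot (W.isTwoTorsionX_baseChange h E)
  · rw [if_pos hc, if_pos ((or_congr h0 h1).mpr hc), map_one]
  · rw [if_neg hc, if_neg (fun hc' => hc ((or_congr h0 h1).mp hc'))]
    ext
    simp only [Units.coe_map, MonoidHom.coe_coe, Units.val_neg, Units.val_one, map_neg, map_one]

/-- **`H¹(χ_θ|_E) ∘ H¹(A⁻¹) = H¹(χ_θ^{W⁄E})`** on `H¹(E, (W⁄E)[2])`: the transport of the Kummer class
of `W⁄E` to `H¹(Γ_E, E[2](K̄)|_{Γ_E})` followed by the restricted character is the `θ`-component of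
`W⁄E`. [cite: SerreGaloisCohomology1997, I §2.4] -/
theorem resOneRootCharH1_cohomologyMap_torsionTransferInvHom (h : W.toAffine.IsTwoTorsionX θ)
    [(W.baseChange E).IsElliptic] (x : galH1Torsion (W.baseChange E) 2) :
    W.resOneRootCharH1 E h
        (cohomologyMap (W.torsionTransferInvHom (E := E) (two_ne_zero : (2 : ℤ) ≠ 0)) 1 x) =
      (W.baseChange E).oneRootCharH1 (W.isTwoTorsionX_baseChange h E) x := by
  obtain ⟨φ, rfl⟩ := oneCocycleClass_surjective _ x
  rw [oneRootCharH1_oneCocycleClass]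
  change W.resOneRootCharH1 E h (cohomologyMap (W.torsionTransferInvHom (E := E) two_ne_zero) 1
    (oneCocycleClass ((W.baseChange E).torsionGaloisModule 2).toTopRep φ)) = _
  rw [cohomologyMap_oneCocycleClass, resOneRootCharH1_oneCocycleClass]
  congr 1
  apply Subtype.ext
  ext σ : 1
  rw [contOneCocycles.pullback_apply, contOneCocycles.pullback_apply, contOneCocycles.pullback_apply]
  change W.resOneRootChar E h ((W.torsionTransferInvHom (E := E) two_ne_zero).hom (φ.1 σ)) =
    (W.baseChange E).oneRootChar (W.isTwoTorsionX_baseChange h E) (φ.1 σ)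
  rw [torsionTransferInvHom_apply]
  exact W.resOneRootChar_torsionTransferEquiv_symm E h (φ.1 σ)

/-! ### The local Kummer image is the Cassels image -/

/-- **The local Kummer image is the one-root descent image of `E(K_v)`** (Silverman AEC X.1.4 / Cassels §15
at the completion, on the tree's local Kummer condition): every class `c` of the local Kummer condition
`𝓛_E = kummerLocalConditionAt W 2 E ⊆ H¹(Γ_E, E[2](K̄)|_{Γ_E})` has `θ`-component, read in `Eˣ/Eˣ²`
through the restricted character and Kummer theory over `E`, equal to the Cassels value
`oneRootComponent θ P` (`x(P) − θ`, or `c(θ)` at `T_θ`, `1` at `O`) of some `P ∈ (W⁄E)(E)` — namely the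
point with `localKummerMap P = c`. [cite: SilvermanAEC2009, Thm. X.1.1, Prop. X.1.4, X.§4 diagram (**)]
[cite: Cassels1991LecturesEllipticCurves, §15 (μ is locally the descent map)] -/
theorem exists_kummerEquiv_resOneRootCharH1_eq_of_mem_kummerLocalConditionAt
    (h : W.toAffine.IsTwoTorsionX θ) [(W.baseChange E).IsElliptic]
    {c : galoisCohomology (GaloisRep.restrictField E (W.torsionGaloisModule 2)) 1}
    (hc : c ∈ W.kummerLocalConditionAt 2 E) :
    ∃ P : (W.baseChange E).toAffine.Point,
      kummerEquiv E 2 (W.resOneRootCharH1 E h c) =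
        Additive.ofMul (Affine.Point.oneRootComponent (W.baseChange E).toAffine (algebraMap K E θ) P) := by
  rw [← W.range_localKummerMap E (two_ne_zero : (2 : ℤ) ≠ 0), AddMonoidHom.mem_range] at hc
  obtain ⟨P, rfl⟩ := hc
  refine ⟨P, ?_⟩
  rw [W.localKummerMap_eq_cohomologyMap_kummerMapTorsion E (two_ne_zero : (2 : ℤ) ≠ 0)
      (W.two_zsmul_geomPoints_baseChange_surjective E) P,
    W.resOneRootCharH1_cohomologyMap_torsionTransferInvHom E h,
    (W.baseChange E).kummerEquiv_oneRootCharH1_kummerMapTorsion (W.isTwoTorsionX_baseChange h E)]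

/-- **The `θ`-component of a global class, localised**: for `c ∈ H¹(K, E[2])` whose restriction to
`Γ_E` lies in the local Kummer condition `𝓛_E` (e.g. `c ∈ Sel⁽²⁾(E/K)` and `E = K_v`), the image in
`Eˣ/Eˣ²` of its global `θ`-component `kummerEquiv K 2 (H¹(χ_θ) c) ∈ Kˣ/Kˣ²` is the Cassels value of a point
`P ∈ E(E)`. [cite: SilvermanAEC2009, Prop. X.1.4, X.§4 diagram (**)] -/
theorem exists_kummerEquiv_resMu_oneRootCharH1_eq_of_res_mem
    (h : W.toAffine.IsTwoTorsionX θ) [(W.baseChange E).IsElliptic] {c : galH1Torsion W 2}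
    (hc : galoisCohomology.res (W.torsionGaloisModule 2) E 1 c ∈ W.kummerLocalConditionAt 2 E) :
    ∃ P : (W.baseChange E).toAffine.Point,
      kummerEquiv E 2 (resMu K E 2 (W.oneRootCharH1 h c)) =
        Additive.ofMul (Affine.Point.oneRootComponent (W.baseChange E).toAffine (algebraMap K E θ) P) := by
  obtain ⟨P, hP⟩ := W.exists_kummerEquiv_resOneRootCharH1_eq_of_mem_kummerLocalConditionAt E h hc
  exact ⟨P, by rw [← resOneRootCharH1_res, hP]⟩

/-- **The same, on square classes**: writing the global `θ`-component as the class of `a ∈ Kˣ`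
(`kummerEquiv K 2 (H¹(χ_θ) c) = [a]`), the class of `a` in `Eˣ/Eˣ²` is the Cassels value of a point of
`E(E)`. [cite: SilvermanAEC2009, Prop. X.1.4, X.§4 diagram (**)] -/
theorem exists_oneRootComponent_eq_of_res_mem (h : W.toAffine.IsTwoTorsionX θ)
    [(W.baseChange E).IsElliptic] {c : galH1Torsion W 2}
    (hc : galoisCohomology.res (W.torsionGaloisModule 2) E 1 c ∈ W.kummerLocalConditionAt 2 E)
    (a : Kˣ) (ha : kummerEquiv K 2 (W.oneRootCharH1 h c) = Additive.ofMul (QuotientGroup.mk a)) :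
    ∃ P : (W.baseChange E).toAffine.Point,
      Affine.Point.oneRootComponent (W.baseChange E).toAffine (algebraMap K E θ) P =
        QuotientGroup.mk (Units.map (algebraMap K E : K →* E) a) := by
  obtain ⟨P, hP⟩ := W.exists_kummerEquiv_resMu_oneRootCharH1_eq_of_res_mem E h hc
  refine ⟨P, ?_⟩
  have hc' : W.oneRootCharH1 h c = (kummerEquiv K 2).symm (Additive.ofMul (QuotientGroup.mk a)) := by
    rw [← ha, AddEquiv.symm_apply_apply]
  rw [hc', kummerEquiv_resMu_symm] at hP
  exact Additive.ofMul.injective hP.symm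

/-! ### Selmer classes over a number field -/

open NumberField

/-- **Selmer classes are locally Cassels classes**: for a number field `K`, a class `c ∈ Sel⁽²⁾(E/K)` with
global `θ`-component `[a] ∈ Kˣ/Kˣ²` (`a ∈ Kˣ`), and a place `v` of `K`, the class of `a` in `K_vˣ/K_vˣ²` is
the Cassels value `oneRootComponent θ P` of a point `P ∈ E(K_v)` (`Sel⁽²⁾ = ⋂_v loc_v⁻¹(𝓛_v)`,
`mem_selmerGroup_iff_forall_localization_mem`). [cite: SilvermanAEC2009, Prop. X.1.4, X.§4 (Prop. X.4.9)]
[cite: Cassels1991LecturesEllipticCurves, §15] -/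
theorem exists_oneRootComponent_eq_of_mem_selmerGroup [NumberField K]
    (h : W.toAffine.IsTwoTorsionX θ) {c : galH1Torsion W 2} (hc : c ∈ selmerGroup W 2)
    (v : Place K) [CharZero (Place.Completion v)] [(W.baseChange (Place.Completion v)).IsElliptic]
    (a : Kˣ) (ha : kummerEquiv K 2 (W.oneRootCharH1 h c) = Additive.ofMul (QuotientGroup.mk a)) :
    ∃ P : (W.baseChange (Place.Completion v)).toAffine.Point,
      Affine.Point.oneRootComponent (W.baseChange (Place.Completion v)).toAffine
          (algebraMap K (Place.Completion v) θ) P =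
        QuotientGroup.mk (Units.map (algebraMap K (Place.Completion v) : K →* Place.Completion v) a) := by
  have hv := (W.mem_selmerGroup_iff_forall_localization_mem 2 c).mp hc v
  exact W.exists_oneRootComponent_eq_of_res_mem (Place.Completion v) h hv a ha

/-! ### A curve over a subfield: the cohomological Cassels map `Φ = kummerEquiv ∘ oneRootDescentH1` -/

/-- **Selmer classes of a curve over a subfield are locally Cassels classes over the root field.** Let
`E/k` be an elliptic curve, `K/k` a number-field extension containing a root `θ` of the `2`-division cubic
(e.g. `k = ℚ`, `K = ℚ(θ)` the cubic `2`-division field), and `Φ = kummerEquiv K 2 ∘ oneRootDescentH1 K hθ :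
H¹(k, E[2]) → Kˣ/Kˣ²` the cohomological Cassels map (restriction to `K` then `H¹(χ_θ)`, injective when
`E[2]` is irreducible, `oneRootDescentH1_injective`). For `c ∈ Sel⁽²⁾(E/k)` with `Φ(c) = [a]`, `a ∈ Kˣ`, and
every place `v` of `K`: the class of `a` in `K_vˣ/K_vˣ²` is the Cassels value of a point of `E(K_v)` —
restriction carries `Sel⁽²⁾(E/k)` into `Sel⁽²⁾(E_K/K)` (`resTorsion_mem_selmerGroup`).
[cite: Cassels1991LecturesEllipticCurves, §15 (μ on 𝔊 and the Selmer group)]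
[cite: SilvermanAEC2009, X.§4 (Prop. X.4.9)] -/
theorem exists_oneRootComponent_eq_of_mem_selmerGroup_of_resTorsion
    {k : Type u} [Field k] [NumberField k] (V : WeierstrassCurve k) [V.IsElliptic]
    [Algebra k K] [NumberField K] [(V.baseChange K).IsElliptic]
    (hθ : (V.baseChange K).toAffine.IsTwoTorsionX θ) {c : galH1Torsion V 2} (hc : c ∈ selmerGroup V 2)
    (v : Place K) [CharZero (Place.Completion v)]
    [((V.baseChange K).baseChange (Place.Completion v)).IsElliptic]
    (a : Kˣ) (ha : kummerEquiv K 2 (V.oneRootDescentH1 K hθ c) = Additive.ofMul (QuotientGroup.mk a)) :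
    ∃ P : ((V.baseChange K).baseChange (Place.Completion v)).toAffine.Point,
      Affine.Point.oneRootComponent ((V.baseChange K).baseChange (Place.Completion v)).toAffine
          (algebraMap K (Place.Completion v) θ) P =
        QuotientGroup.mk (Units.map (algebraMap K (Place.Completion v) : K →* Place.Completion v) a) := by
  rw [oneRootDescentH1_apply] at ha
  exact (V.baseChange K).exists_oneRootComponent_eq_of_mem_selmerGroup hθ
    (resTorsion_mem_selmerGroup V K 2 hc) v a ha

end WeierstrassCurve

end
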